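import Summits.Ventures.PercRepro.ProfileGapMonoGeneric
import Summits.Ventures.PercRepro.ProfileGapMonoHard

/-!
# PercRepro — `q`-GENERIC POINTS ARE GAP-MONOTONE AT EVERY LEVEL, and the final form of the reduction: `C025` from a
gap-monotone point in every simple matroid in which EVERY point lies on a cocircuit of rank `≤ q`
(p10, gen 7; `proofs/P10-AVFULL.md` §15)

ProfileGapMonoGeneric proved `gapMonoQ_of_generic` in the regime `ρ(E) ≥ u + q`, where the new supply under the
deletion of a generic `z` is exactly the rank-`(u−1)` sets of `M ／ z`.  At the high levels the co-rank-`(q−1)` sets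
`S'` of `N = M ／ z` whose complement is `z`-free of rank `q − 1` are not through-`z` supply — but they are exactly the
LOST sets (`S'` itself has rank `u` in `M`, its complement in `M` has rank `q`, in `M ∖ z` only `q − 1`), so the
injection `S' ↦ S' ∪ z` (good) / `S' ↦ S'` (lost) still shows `W⁻_{q,u}(M) ≥ W⁻_{q,u}(M ∖ z) + W⁻_{q−1,u−1}(N)`
(`card_levelSetCoQ_delete_add_le`), and `gapMonoQ_of_generic'` holds for every `1 ≤ q < u`.  Hence `HardRuleQ'`:
`C025` follows from a gap-monotone point in every SIMPLE matroid on at least `u + q + 1` elements in which every point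
lies on a cocircuit of rank `≤ q` (`c025_of_hardRuleQ'`).

* `levelSetCoQ_delete_subset_gen`, `mem_levelSetCoQ_of_generic_good`, `mem_levelSetCoQ_of_generic_bad`,
  **`card_levelSetCoQ_delete_add_le`**, **`gapMonoQ_of_generic'`**, `HardRuleQ'`,
  **`profileIneqMinusQ_of_hardRuleQ'`**, **`c025_of_hardRuleQ'`**.
-/

open scoped Matroid

namespace PercRepro.Cogirth

open Finset ThmH Skew Shadow Profile

variable {α : Type} [DecidableEq α] {M : Matroid α} [M.Finite]

/-- The co-rank-`q` level set of `M ∖ z` sits inside that of `M`. -/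
theorem levelSetCoQ_delete_subset_gen (z : α) (q u : ℕ) : levelSetCoQ (M ＼ ({z} : Set α)) q u ⊆ levelSetCoQ M q u := by
  intro S hS
  rw [mem_levelSetCoQ, gr_delete'] at hS
  rw [mem_levelSetCoQ]
  obtain ⟨⟨hS1, hS2⟩, hS3⟩ := hS
  refine ⟨⟨hS1.trans (erase_subset _ _), ?_⟩, ?_⟩
  · rw [← coe_rk, rk_delete hS1, coe_rk] at hS2
    exact hS2
  · rw [rk_delete sdiff_subset] at hS3
    have hsub : (gr M).erase z \ S ⊆ gr M \ S := sdiff_subset_sdiff (erase_subset _ _) (Subset.refl _)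
    exact hS3.trans (rk_mono_sub hsub)

/-- A co-rank-`(q−1)` set `S'` of `N = M ／ z` at level `u − 1` whose complement has `M`-rank `≥ q` gives the
through-`z` set `S' ∪ z` of `W⁻_{q,u}(M)` (`z` a non-loop, `1 ≤ u`). -/
theorem mem_levelSetCoQ_of_generic_good {z : α} (hzI : M.Indep {z}) {q u : ℕ} (hu : 1 ≤ u) {S' : Finset α}
    (hS' : S' ∈ levelSetCoQ (M ／ ({z} : Set α)) (q - 1) (u - 1))
    (hgood : q ≤ rk M ((gr M).erase z \ S')) : insert z S' ∈ levelSetCoQ M q u := by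
  have hz : z ∈ gr M := mem_gr_of_indep hzI
  rw [mem_levelSetCoQ, gr_contract'] at hS'
  obtain ⟨⟨hS1, hS2⟩, _⟩ := hS'
  rw [mem_levelSetCoQ]
  have hr : rk (M ／ ({z} : Set α)) S' = u - 1 := by
    rw [← coe_rk] at hS2
    exact_mod_cast hS2
  have hset : gr M \ insert z S' = (gr M).erase z \ S' := by
    ext x
    simp only [mem_sdiff, mem_insert, mem_erase, not_or]
    tauto
  refine ⟨⟨insert_subset hz (hS1.trans (erase_subset _ _)), ?_⟩, ?_⟩
  · rw [← coe_rk, ← rk_contract_add_one hzI hS1, hr]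
    congr 1
    omega
  · rw [hset]
    exact hgood

/-- A co-rank-`(q−1)` set `S'` of `N = M ／ z` at level `u − 1` whose complement has `M`-rank `< q` is a LOST set:
at a `q`-generic `z` it lies in `W⁻_{q,u}(M)` itself (`1 ≤ u`). -/
theorem mem_levelSetCoQ_of_generic_bad {z : α} (hzI : M.Indep {z}) {q u : ℕ} (hq : 1 ≤ q) (hu : 1 ≤ u)
    (hg : GenericQ M z q) {S' : Finset α} (hS' : S' ∈ levelSetCoQ (M ／ ({z} : Set α)) (q - 1) (u - 1))
    (hbad : rk M ((gr M).erase z \ S') < q) : S' ∈ levelSetCoQ M q u := by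
  have hz : z ∈ gr M := mem_gr_of_indep hzI
  rw [mem_levelSetCoQ, gr_contract'] at hS'
  obtain ⟨⟨hS1, hS2⟩, hS3⟩ := hS'
  have hr : rk (M ／ ({z} : Set α)) S' = u - 1 := by
    rw [← coe_rk] at hS2
    exact_mod_cast hS2
  -- the complement `Y := E' ∖ S'` has `M`-rank `q − 1` and is `z`-free
  have hY : rk (M ／ ({z} : Set α)) ((gr M).erase z \ S') + 1 = rk M (insert z ((gr M).erase z \ S')) :=
    rk_contract_add_one hzI sdiff_subset
  have hYM : rk M ((gr M).erase z \ S') ≤ rk M (insert z ((gr M).erase z \ S')) := rk_mono_sub (subset_insert _ _)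
  have hYle : rk M (insert z ((gr M).erase z \ S')) ≤ rk M ((gr M).erase z \ S') + 1 := rk_insert_le _ _
  -- genericity at `Y`: `z ∈ cl(E' ∖ Y) = cl(S')`
  have hYY : (gr M).erase z \ ((gr M).erase z \ S') = S' := Finset.sdiff_sdiff_eq_self hS1
  have hcl : z ∈ clF M S' := by
    have h := hg ((gr M).erase z \ S') sdiff_subset (by omega)
    rwa [hYY] at h
  have hrS : rk M S' = u := by
    have h1 := rk_contract_add_one hzI hS1
    rw [rk_insert_eq hz (hS1.trans (erase_subset _ _)), if_pos hcl] at h1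
    omega
  rw [mem_levelSetCoQ]
  refine ⟨⟨hS1.trans (erase_subset _ _), ?_⟩, ?_⟩
  · rw [← coe_rk, hrS]
  · -- `E ∖ S' = Y ∪ z` has rank `q`
    have hset : gr M \ S' = insert z ((gr M).erase z \ S') := by
      ext x
      simp only [mem_sdiff, mem_insert, mem_erase]
      constructor
      · rintro ⟨hxE, hxS⟩
        by_cases hxz : x = z
        · exact Or.inl hxz
        · exact Or.inr ⟨⟨hxz, hxE⟩, hxS⟩
      · rintro (rfl | ⟨⟨_, hxE⟩, hxS⟩)
        · exact ⟨hz, fun h => (mem_erase.1 (hS1 h)).1 rfl⟩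
        · exact ⟨hxE, hxS⟩
    rw [hset]
    omega

/-- **The supply bound at a generic point, every level**:
`W⁻_{q,u}(M ∖ z) + W⁻_{q−1,u−1}(M ／ z) ≤ W⁻_{q,u}(M)`. -/
theorem card_levelSetCoQ_delete_add_le {z : α} (hzI : M.Indep {z}) {q u : ℕ} (hq : 1 ≤ q) (hu : 1 ≤ u)
    (hg : GenericQ M z q) :
    (levelSetCoQ (M ＼ ({z} : Set α)) q u).card + (levelSetCoQ (M ／ ({z} : Set α)) (q - 1) (u - 1)).card ≤
      (levelSetCoQ M q u).card := by
  set g : Finset α → Finset α := fun S' => if q ≤ rk M ((gr M).erase z \ S') then insert z S' else S' with hgdef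
  have hz : z ∈ gr M := mem_gr_of_indep hzI
  -- `g` maps `W⁻_{q−1,u−1}(N)` into `W⁻_{q,u}(M)`
  have hmaps : ∀ S' ∈ levelSetCoQ (M ／ ({z} : Set α)) (q - 1) (u - 1), g S' ∈ levelSetCoQ M q u := by
    intro S' hS'
    simp only [hgdef]
    split_ifs with h
    · exact mem_levelSetCoQ_of_generic_good hzI hu hS' h
    · exact mem_levelSetCoQ_of_generic_bad hzI hq hu hg hS' (by omega)
  -- `g` is injective there
  have hzS : ∀ S' ∈ levelSetCoQ (M ／ ({z} : Set α)) (q - 1) (u - 1), z ∉ S' := by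
    intro S' hS'
    rw [mem_levelSetCoQ, gr_contract'] at hS'
    exact fun h => (mem_erase.1 (hS'.1.1 h)).1 rfl
  have hinj : Set.InjOn g (levelSetCoQ (M ／ ({z} : Set α)) (q - 1) (u - 1) : Set (Finset α)) := by
    intro S₁ h₁ S₂ h₂ heq
    have hz₁ := hzS S₁ h₁
    have hz₂ := hzS S₂ h₂
    simp only [hgdef] at heq
    split_ifs at heq with c₁ c₂ c₂
    · have := congrArg (fun T => T.erase z) heq
      simp only [erase_insert hz₁, erase_insert hz₂] at this
      exact this
    · exact absurd (heq ▸ mem_insert_self z S₁) hz₂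
    · exact absurd (heq.symm ▸ mem_insert_self z S₂) hz₁
    · exact heq
  -- the image is disjoint from `W⁻_{q,u}(M ∖ z)`
  have hdisj : Disjoint (levelSetCoQ (M ＼ ({z} : Set α)) q u)
      ((levelSetCoQ (M ／ ({z} : Set α)) (q - 1) (u - 1)).image g) := by
    rw [disjoint_left]
    intro S hS hS'
    rw [mem_image] at hS'
    obtain ⟨S', hS'mem, hgS'⟩ := hS'
    rw [mem_levelSetCoQ, gr_delete'] at hS
    simp only [hgdef] at hgS'
    split_ifs at hgS' with c
    · -- `S = insert z S'` contains `z`, but `S ⊆ E ∖ z`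
      have := hS.1.1 (hgS' ▸ mem_insert_self z S')
      exact (mem_erase.1 this).1 rfl
    · -- `S = S'` has complement of rank `< q` in `M ∖ z`
      subst hgS'
      have h := hS.2
      rw [rk_delete sdiff_subset] at h
      omega
  have hcard := card_le_card (union_subset (levelSetCoQ_delete_subset_gen z q u)
    (fun S hS => by rw [mem_image] at hS; obtain ⟨S', hS', rfl⟩ := hS; exact hmaps S' hS'))
  rw [card_union_of_disjoint hdisj, card_image_of_injOn hinj] at hcard
  exact hcard

/-- **`q`-GENERIC POINTS ARE GAP-MONOTONE AT EVERY LEVEL**: for `z` `q`-generic and `1 ≤ q < u`, the row `(q−1, u−1)`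
of `M ／ z` gives `GapMonoQ M z q u`. -/
theorem gapMonoQ_of_generic' {z : α} (hzI : M.Indep {z}) {q u : ℕ} (hq : 1 ≤ q) (hqu : q < u)
    (hg : GenericQ M z q) (hdel : ProfileIneqMinusQ (M ／ ({z} : Set α)) (q - 1) (u - 1)) : GapMonoQ M z q u := by
  have hz : z ∈ gr M := mem_gr_of_indep hzI
  unfold GapMonoQ
  unfold ProfileIneqMinusQ at hdel
  have hD : ∑ B ∈ Rq M q, demand M q u B =
      ∑ B ∈ Rq (M ＼ ({z} : Set α)) q, demand (M ＼ ({z} : Set α)) q u B +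
      ∑ B' ∈ Rq (M ／ ({z} : Set α)) (q - 1), demand M q u (insert z B') := by
    rw [← sum_filter_add_sum_filter_not (Rq M q) (fun B => z ∈ B), sum_Rq_filter_mem_contract hzI hq,
      Rq_delete_eq_filter, add_comm]
    congr 1
    apply sum_congr rfl
    intro B hB
    rw [mem_filter] at hB
    rw [demand_delete_eq_of_generic hz hg u hB.1 hB.2]
  have hthrough : q * ∑ B' ∈ Rq (M ／ ({z} : Set α)) (q - 1), demand M q u (insert z B') ≤
      u * ∑ B' ∈ Rq (M ／ ({z} : Set α)) (q - 1), demand (M ／ ({z} : Set α)) (q - 1) (u - 1) B' := by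
    rw [mul_sum, mul_sum]
    apply sum_le_sum
    intro B' hB'
    rw [demand_insert_of_generic hzI hq hg u hB']
    unfold demand
    split_ifs with h1 h2 h2
    · rw [show u - 1 - (q - 1) = u - q by omega]
      exact choose_succ_mul_le hq hqu (by omega)
    · omega
    · omega
    · exact le_refl _
  have hcq : u * (u - 1).choose (q - 1) = q * u.choose q := by
    have := Nat.add_one_mul_choose_eq (u - 1) (q - 1)
    rw [show u - 1 + 1 = u by omega, show q - 1 + 1 = q by omega] at this
    rw [this]
    ring
  have hsupply := card_levelSetCoQ_delete_add_le (u := u) hzI hq (by omega) hg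
  have hkey : q * ∑ B' ∈ Rq (M ／ ({z} : Set α)) (q - 1), demand M q u (insert z B') ≤
      q * (u.choose q * (levelSetCoQ (M ／ ({z} : Set α)) (q - 1) (u - 1)).card) := by
    calc q * ∑ B' ∈ Rq (M ／ ({z} : Set α)) (q - 1), demand M q u (insert z B')
        ≤ u * ∑ B' ∈ Rq (M ／ ({z} : Set α)) (q - 1), demand (M ／ ({z} : Set α)) (q - 1) (u - 1) B' := hthrough
      _ ≤ u * ((u - 1).choose (q - 1) * (levelSetCoQ (M ／ ({z} : Set α)) (q - 1) (u - 1)).card) :=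
          Nat.mul_le_mul_left _ hdel
      _ = (u * (u - 1).choose (q - 1)) * (levelSetCoQ (M ／ ({z} : Set α)) (q - 1) (u - 1)).card := by ring
      _ = (q * u.choose q) * (levelSetCoQ (M ／ ({z} : Set α)) (q - 1) (u - 1)).card := by rw [hcq]
      _ = q * (u.choose q * (levelSetCoQ (M ／ ({z} : Set α)) (q - 1) (u - 1)).card) := by ring
  have hT : ∑ B' ∈ Rq (M ／ ({z} : Set α)) (q - 1), demand M q u (insert z B') ≤
      u.choose q * (levelSetCoQ (M ／ ({z} : Set α)) (q - 1) (u - 1)).card := Nat.le_of_mul_le_mul_left hkey (by omega)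
  have hmul : u.choose q * (levelSetCoQ (M ＼ ({z} : Set α)) q u).card +
      u.choose q * (levelSetCoQ (M ／ ({z} : Set α)) (q - 1) (u - 1)).card ≤ u.choose q * (levelSetCoQ M q u).card := by
    rw [← Nat.mul_add]
    exact Nat.mul_le_mul_left _ hsupply
  rw [hD]
  omega

/-- **The final hard rule**: a gap-monotone point in every simple matroid on at least `u + q + 1` elements in which
EVERY point lies on a cocircuit of rank `≤ q` (no `q`-generic point). -/
def HardRuleQ' (α : Type) [DecidableEq α] : Prop :=
  ∀ (q u : ℕ), q < u → ∀ (N : Matroid α) [N.Finite], Simple' N → u + q + 1 ≤ (gr N).card →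
    (∀ z ∈ gr N, ¬ GenericQ N z q) → ∃ z ∈ gr N, GapMonoQ N z q u

/-- **THE FINAL REDUCTION**: the co-rank-`q` row of every finite matroid from the final hard rule. -/
theorem profileIneqMinusQ_of_hardRuleQ'_aux (hrule : HardRuleQ' α) (n : ℕ) :
    ∀ (K : Matroid α) [K.Finite], (gr K).card = n → ∀ q u : ℕ, q < u → ProfileIneqMinusQ K q u := by
  induction n using Nat.strong_induction_on with
  | _ n ih =>
    intro K _ hn q u hqu
    rcases Nat.eq_zero_or_pos q with hq0 | hq
    · rw [hq0]
      exact profileIneqMinusQ_zero K u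
    by_cases hsmall : (gr K).card ≤ u + q
    · exact profileIneqMinusQ_of_card_le hqu.le hsmall
    push Not at hsmall
    have hIH : ∀ z ∈ gr K, ProfileIneqMinusQ (K ＼ ({z} : Set α)) q u := by
      intro z hz
      have hcard : (gr (K ＼ ({z} : Set α))).card = n - 1 := by
        rw [gr_delete', card_erase_of_mem hz, hn]
      have hlt : n - 1 < n := by
        have := card_pos.2 ⟨z, hz⟩
        omega
      exact ih (n - 1) hlt _ hcard q u hqu
    by_cases hl : ∃ ℓ ∈ gr K, rk K {ℓ} = 0
    · obtain ⟨ℓ, hℓ, h0⟩ := hl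
      exact profileIneqMinusQ_of_gapMonoQ (gapMonoQ_of_loop hℓ h0 (hIH ℓ hℓ)) (hIH ℓ hℓ)
    push Not at hl
    have h1 : ∀ x ∈ gr K, rk K {x} = 1 := by
      intro x hx
      have := rk_le_card (M := K) ({x} : Finset α)
      rw [card_singleton] at this
      have := hl x hx
      omega
    by_cases hp : ∃ z ∈ gr K, ∃ z' ∈ gr K, z ≠ z' ∧ rk K {z, z'} = 1
    · obtain ⟨z, hz, z', hz', hzz', hpar⟩ := hp
      have hcard : (gr ((K ＼ ({z} : Set α)) ／ ({z'} : Set α))).card = n - 2 := by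
        rw [gr_contract', gr_delete', card_erase_of_mem (mem_erase.2 ⟨Ne.symm hzz', hz'⟩), card_erase_of_mem hz, hn]
        omega
      have hlt : n - 2 < n := by
        have := card_pos.2 ⟨z, hz⟩
        omega
      have hdel := ih (n - 2) hlt _ hcard (q - 1) (u - 1) (by omega)
      exact profileIneqMinusQ_of_gapMonoQ
        (gapMonoQ_of_parallel hz hz' hzz' (h1 z hz) (h1 z' hz') hpar hq hqu hdel) (hIH z hz)
    push Not at hp
    have h2 : ∀ x ∈ gr K, ∀ y ∈ gr K, x ≠ y → rk K {x, y} = 2 := by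
      intro x hx y hy hxy
      have hle := rk_le_card (M := K) ({x, y} : Finset α)
      rw [card_pair hxy] at hle
      have hge : rk K {x} ≤ rk K {x, y} := rk_mono_sub (by simp)
      have hne := hp x hx y hy hxy
      have := h1 x hx
      omega
    have hs : Simple' K := simple'_of_rk_one_two h1 h2
    by_cases hgen : ∃ z ∈ gr K, GenericQ K z q
    · obtain ⟨z, hz, hg⟩ := hgen
      have hzI : K.Indep {z} := by
        have h := indep_of_rk_eq_card (M := K) (X := {z}) (by rw [card_singleton]; exact h1 z hz)
        rwa [coe_singleton] at h
      have hcard : (gr (K ／ ({z} : Set α))).card = n - 1 := by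
        rw [gr_contract', card_erase_of_mem hz, hn]
      have hlt : n - 1 < n := by
        have := card_pos.2 ⟨z, hz⟩
        omega
      have hdel := ih (n - 1) hlt _ hcard (q - 1) (u - 1) (by omega)
      exact profileIneqMinusQ_of_gapMonoQ (gapMonoQ_of_generic' hzI hq hqu hg hdel) (hIH z hz)
    push Not at hgen
    obtain ⟨z, hz, hgm⟩ := hrule q u hqu K hs (by omega) hgen
    exact profileIneqMinusQ_of_gapMonoQ hgm (hIH z hz)

/-- The co-rank-`q` row of every finite matroid from the final hard rule. -/
theorem profileIneqMinusQ_of_hardRuleQ' (hrule : HardRuleQ' α) (K : Matroid α) [K.Finite] {q u : ℕ}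
    (hqu : q < u) : ProfileIneqMinusQ K q u :=
  profileIneqMinusQ_of_hardRuleQ'_aux hrule _ K rfl q u hqu

/-- The plain row from the final hard rule. -/
theorem profileIneq_of_hardRuleQ' (hrule : HardRuleQ' α) (K : Matroid α) [K.Finite] {q u : ℕ}
    (hqu : q < u) : ProfileIneq K q u :=
  profileIneq_of_minusQ hqu.le (profileIneqMinusQ_of_hardRuleQ' hrule K hqu)

end PercRepro.Cogirth

namespace PercRepro

/-- **`C025Profile` FROM THE FINAL HARD RULE.** -/
theorem c025Profile_of_hardRuleQ' (h : ∀ (α : Type) [DecidableEq α], Cogirth.HardRuleQ' α) : C025Profile := by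
  intro α _ M _ q u hqu
  exact Cogirth.profileIneq_of_hardRuleQ' (h α) M hqu

/-- **`C025` FROM THE FINAL HARD RULE**: a gap-monotone point in every simple matroid in which every point lies on a
cocircuit of rank `≤ q`. -/
theorem c025_of_hardRuleQ' (h : ∀ (α : Type) [DecidableEq α], Cogirth.HardRuleQ' α) : C025 :=
  c025_of_profile (c025Profile_of_hardRuleQ' h)

end PercRepro
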